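import Literature.Analysis.FluidPDE.ForcedFourierMildFamily
import Literature.Analysis.FluidPDE.TaoH1FourierMildSolution
import HarnessLib

/-!
# The classical solution synthesized from a FORCED Fourier-side `H¹`-mild solution of Sobolev
# class (classical half of the forced engine, file 2)

Forced twin of `TaoH1FourierMildSolution.lean` (T. Tao, Anal. PDE 6 (2013) = arXiv:1108.1165,
Thm. 5.4 (iv) = arXiv Thm. 31 (iv), p. 18: for an `H¹` mild solution `(u, p, u₀, f, T)` with
Schwartz data, "`u` and `p` are smooth", and the solution solves the forced system (3)–(5)).
Given a heat rate `c = 4π²ν`, `ν ≥ 0`, a datum `a` of Sobolev class, PROJECTED force coefficients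
`b` with a derivative tower `B` (`B 0 = b`, every component of `B` a square-dominated Fourier
family of every order on `[0, T]`, `∂ₜ B_k = B_{k+1}`; supplied for a Schwartz-on-slab physical
force by the physical-transfer file of seat `ns-blowup-lit`) and `v` with
`IsSobolevMildForced c T a b v` on `[0, T]`, `T > 0` (`ForcedFourierDuhamelDefs.lean`, seat
`ns-blowup-lean2`), the physical fields are

  `u(t, x) = synthVel (v t) x = Re 𝓕 v(t)(x)`,  `p(t, x) = Re 𝓕 q(t)(x)`,  `q(t) = presSymbol (v t) (v t)`,
  `g(t, x) = synthVel (b t) x = Re 𝓕 b(t)(x)` (the projected force `P f`),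

and this file proves that `(u, p)` is a **classical solution of the Navier–Stokes system with
force `g` on the closed slab `[0, T] × E`** (`IsSobolevMildForced.isClassicalNSSolutionOn`):
joint smoothness from the square-dominated families of `ForcedFourierMildFamily` and the synthesis
theorem `contDiffOn_synth_infty_dom`; the equations term by term through the dictionary
(`∂ₜ ↔ -c‖ξ‖² − N + b`, `∂_h ↔ -2πi⟪ξ, h⟫`, `Δ ↔ -4π²‖ξ‖²`, products ↔ convolutions), the
incompressibility of `v` and the Fourier-side identity `G − N − 2πi ξ q = 0` (for a projected =
divergence-free force the pressure is the unforced Riesz-transform pressure; Tao's (8)–(9)). Every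
`x`-space statement (gradient, divergence, Laplacian, convective term, pressure gradient) is the
unforced one VERBATIM — they only use the envelopes of the time slice `v t`; the force enters the
time derivative and the momentum balance. No definitions are introduced.

## Mathlib / tree search

Reused: the dictionary lemmas `fderiv_fourier_apply_of_integrable`, `laplacian_fourier_of_moments`,
`integrable_letterSymbol_mul`, `momentum_symbol_identity`, `synthVel_eq_comp`
(`TaoH1FourierMildSolution`); `synthVel`, `ClayDatum.reVec` (`NSFourierSobolev`, `NSFourierSolution`),
`fourier_add'`/`fourier_sub'`/`fourier_const_mul'`/`fourier_finset_sum'`/`fourier_mul_fourier'`/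
`fourier_eq_re_of_conj_symm` (`NSFourierDictionary`), `contDiffOn_synth_infty_dom`,
`hasDerivWithinAt_synth_time_dom` (`NSRegFourierSynthesis`), `IsDomFamily.integrable`
(`NSRegFourierFamily`), `IsSobolevMildForced.exists_family/_presFamily/_nonlinFamily/exists_dom/
hasDerivWithinAt_apply` (`ForcedFourierMildFamily`). `lean search 'IsSobolevMildForced.isClassical'`:
no hits before this file.

## References

* T. Tao, arXiv:1108.1165 = Anal. PDE 6 (2013), Thm. 5.4 (iv) (arXiv Thm. 31, p. 18), the
  projected equation (8) and the pressure (9), p. 6. [Tao2011]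
* J. Leray, Acta Math. 63 (1934), §19. [Leray1934]
* P. G. Lemarié-Rieusset, *The Navier–Stokes problem in the 21st century*, CRC 2016, §6.1.
-/

noncomputable section

open MeasureTheory Real Set Filter Function Complex FourierTransform VectorFourier
  InnerProductSpace
open scoped FourierTransform RealInnerProductSpace ENNReal ContDiff ComplexConjugate Laplacian
open _root_.Topology

namespace Literature.Analysis.FluidPDE.FourierNS

variable {ι : Type*} [Fintype ι]

section Solution

variable [DecidableEq ι]
variable {c T : ℝ} {a : EuclideanSpace ℝ ι → ι → ℂ} {b : ℝ → EuclideanSpace ℝ ι → ι → ℂ}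
  {B : ℕ → ℝ → EuclideanSpace ℝ ι → ι → ℂ} {v : ℝ → EuclideanSpace ℝ ι → ι → ℂ}

open ClayDatum (reVec reVec_apply)

/-! ### The solution: integrability of the coefficient slices -/

/-- **Integrable moments of every order of the components** of a forced mild solution, at every
time (`‖ξ‖^m ‖v(t, ξ)ₗ‖ ≤ G_{m+K₀}(ξ) (1+‖ξ‖)^{-K₀}`, a product of two `L²` functions).
[cite: Tao2011, Thm. 5.4 (iv) (arXiv Thm. 31)] -/
theorem IsSobolevMildForced.integrable_pow_mul_norm (h : IsSobolevMildForced c T a b v) (hc : 0 ≤ c)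
    (ha : IsSobolevFourierDatum a) (m : ℕ) (t : ℝ) (l : ι) :
    Integrable fun ξ : EuclideanSpace ℝ ι => ‖ξ‖ ^ m * ‖v t ξ l‖ := by
  set K₀ := Fintype.card ι + 1 with hK₀
  obtain ⟨G, hG, hle⟩ := h.exists_dom hc ha (m + K₀) l
  have hw : MemLp (fun ξ : EuclideanSpace ℝ ι => ((1 + ‖ξ‖) ^ K₀)⁻¹) 2 volume :=
    memLp_inv_one_add_norm_pow_two
  refine (hG.integrable_mul hw).mono' ((continuous_norm.pow m).aestronglyMeasurable.mul
    (h.aesm_apply t l).norm) (Eventually.of_forall fun ξ => ?_)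
  rw [Real.norm_of_nonneg (by positivity)]
  change ‖ξ‖ ^ m * ‖v t ξ l‖ ≤ G ξ * ((1 + ‖ξ‖) ^ K₀)⁻¹
  have hpos : 0 < (1 + ‖ξ‖) ^ K₀ := by positivity
  rw [le_mul_inv_iff₀ hpos]
  have h1 : ‖ξ‖ ^ m ≤ (1 + ‖ξ‖) ^ m :=
    pow_le_pow_left₀ (norm_nonneg _) (le_add_of_nonneg_left zero_le_one) m
  calc ‖ξ‖ ^ m * ‖v t ξ l‖ * (1 + ‖ξ‖) ^ K₀ ≤ (1 + ‖ξ‖) ^ m * ‖v t ξ l‖ * (1 + ‖ξ‖) ^ K₀ := by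
        gcongr
    _ = (1 + ‖ξ‖) ^ (m + K₀) * ‖v t ξ l‖ := by rw [pow_add]; ring
    _ ≤ G ξ := hle t ξ

/-- Components of a forced mild solution are integrable at every time. [cite: Tao2011, Thm. 5.4 (iv) (arXiv Thm. 31)] -/
theorem IsSobolevMildForced.integrable_apply (h : IsSobolevMildForced c T a b v) (hc : 0 ≤ c)
    (ha : IsSobolevFourierDatum a) (t : ℝ) (l : ι) : Integrable fun ξ => v t ξ l := by
  have := h.integrable_pow_mul_norm hc ha 0 t l
  simp only [pow_zero, one_mul] at this
  exact (integrable_norm_iff (h.aesm_apply t l)).1 this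

/-- The nonlinearity slice along a forced mild solution has every pointwise decay on `[0, T]`,
with measurable slices (from the order-`0` nonlinearity family; the force tower is used at order
`0` only). [cite: Tao2011, Thm. 5.4 (iv) (arXiv Thm. 31)] -/
theorem IsSobolevMildForced.hasDecay_nonlin (h : IsSobolevMildForced c T a b v) (hc : 0 ≤ c)
    (hT : 0 < T) (ha : IsSobolevFourierDatum a) (hB0 : B 0 = b)
    (hB : ∀ n l, IsDomFamily T n (fun k t ξ => B k t ξ l)) (K : ℕ) (l : ι) :
    ∃ C, ∀ t ∈ Icc 0 T, HasDecay K C (fun ξ => nonlin (v t) (v t) ξ l) ∧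
      AEStronglyMeasurable (fun ξ => nonlin (v t) (v t) ξ l) volume := by
  obtain ⟨M, hM0, hM⟩ := h.exists_nonlinFamily hc hT ha 0 hB0 (hB 0)
  obtain ⟨C, hC⟩ := (hM l).decay 0 le_rfl K
  refine ⟨C, fun t ht => ⟨fun ξ => ?_, ?_⟩⟩
  · have := hC t ht ξ
    simp only [hM0 t ξ] at this
    exact this
  · have := (hM l).meas 0 le_rfl t ht
    exact this.congr (Eventually.of_forall fun ξ => by simp only [hM0 t ξ])

/-- The pressure symbol along a forced mild solution has every pointwise decay on `[0, T]`, with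
measurable slices. [cite: Tao2011, Thm. 5.4 (iv) (arXiv Thm. 31), (9)] -/
theorem IsSobolevMildForced.hasDecay_presSymbol (h : IsSobolevMildForced c T a b v) (hc : 0 ≤ c)
    (hT : 0 < T) (ha : IsSobolevFourierDatum a) (hB0 : B 0 = b)
    (hB : ∀ n l, IsDomFamily T n (fun k t ξ => B k t ξ l)) (K : ℕ) :
    ∃ C, ∀ t ∈ Icc 0 T, HasDecay K C (presSymbol (v t) (v t)) ∧
      AEStronglyMeasurable (presSymbol (v t) (v t)) volume := by
  obtain ⟨Q, hQ0, hQ⟩ := h.exists_presFamily hc hT ha 0 hB0 (hB 0)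
  obtain ⟨C, hC⟩ := hQ.decay 0 le_rfl K
  refine ⟨C, fun t ht => ⟨fun ξ => ?_, ?_⟩⟩
  · have := hC t ht ξ
    rwa [hQ0 t ξ] at this
  · have := hQ.meas 0 le_rfl t ht
    exact this.congr (Eventually.of_forall fun ξ => by simp only [hQ0 t ξ])

omit [DecidableEq ι] in
/-- The force slice `b t` is integrable on `[0, T]` (order-`0` member of a square-dominated
family). [cite: Tao2011, Thm. 5.4 (iv) (arXiv Thm. 31)] -/
theorem integrable_force_apply (hB0 : B 0 = b)
    (hB : ∀ n l, IsDomFamily T n (fun k t ξ => B k t ξ l)) {t : ℝ} (ht : t ∈ Icc 0 T) (l : ι) :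
    Integrable fun ξ => b t ξ l := by
  have := (hB 0 l).integrable (k := 0) le_rfl ht
  simpa only [hB0] using this

omit [DecidableEq ι] in
/-- The force is continuous in time on `[0, T]` at every frequency (as a vector).
[cite: Tao2011, Thm. 5.4 (iv) (arXiv Thm. 31)] -/
theorem continuousOn_force (hB0 : B 0 = b)
    (hB : ∀ n l, IsDomFamily T n (fun k t ξ => B k t ξ l)) (ξ : EuclideanSpace ℝ ι) :
    ContinuousOn (fun t => b t ξ) (Icc 0 T) := by
  rw [continuousOn_pi]
  intro l
  have := (hB 0 l).cont 0 (Nat.zero_le _) ξ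
  simpa only [hB0] using this

/-! ### Smoothness on the closed slab -/

/-- **The velocity `u(t) = synthVel (v t)` of a forced mild solution is jointly smooth on
`[0, T] × E`** (all time-derivative families exist, given the force tower). [cite: Tao2011, Thm. 5.4 (iv) (arXiv Thm. 31)] -/
theorem IsSobolevMildForced.smooth_u (h : IsSobolevMildForced c T a b v) (hc : 0 ≤ c) (hT : 0 < T)
    (ha : IsSobolevFourierDatum a) (hB0 : B 0 = b)
    (hB : ∀ n l, IsDomFamily T n (fun k t ξ => B k t ξ l)) :
    IsSmoothSpaceTimeOn (Icc 0 T) (fun t => synthVel (v t)) := by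
  unfold IsSmoothSpaceTimeOn
  refine (contDiffOn_euclidean (ι := ι) (𝕜 := ℝ)).2 fun l => ?_
  have h1 : ContDiffOn ℝ ∞ (fun z : ℝ × EuclideanSpace ℝ ι => 𝓕 (fun ξ => v z.1 ξ l) z.2)
      (Icc 0 T ×ˢ univ) := by
    refine contDiffOn_synth_infty_dom (W₀ := fun t ξ => v t ξ l) hT fun n => ?_
    obtain ⟨W, hW0, hW⟩ := h.exists_family hc hT ha n hB0 (hB n)
    exact ⟨fun k t ξ => W k t ξ l, by funext t ξ; simp only [hW0], hW l⟩
  exact Complex.reCLM.contDiff.comp_contDiffOn h1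

/-- **The pressure `p(t) = Re 𝓕 presSymbol (v t) (v t)` of a forced mild solution is jointly
smooth on `[0, T] × E`.** [cite: Tao2011, Thm. 5.4 (iv) (arXiv Thm. 31), (9)] -/
theorem IsSobolevMildForced.smooth_p (h : IsSobolevMildForced c T a b v) (hc : 0 ≤ c) (hT : 0 < T)
    (ha : IsSobolevFourierDatum a) (hB0 : B 0 = b)
    (hB : ∀ n l, IsDomFamily T n (fun k t ξ => B k t ξ l)) :
    IsSmoothSpaceTimeOn (Icc 0 T) (fun t x => (𝓕 (presSymbol (v t) (v t)) x).re) := by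
  unfold IsSmoothSpaceTimeOn
  have h1 : ContDiffOn ℝ ∞ (fun z : ℝ × EuclideanSpace ℝ ι => 𝓕 (presSymbol (v z.1) (v z.1)) z.2)
      (Icc 0 T ×ˢ univ) := by
    refine contDiffOn_synth_infty_dom (W₀ := fun t => presSymbol (v t) (v t)) hT fun n => ?_
    obtain ⟨Q, hQ0, hQ⟩ := h.exists_presFamily hc hT ha n hB0 (hB n)
    exact ⟨Q, by funext t ξ; exact hQ0 t ξ, hQ.isDomFamily⟩
  exact Complex.reCLM.contDiff.comp_contDiffOn h1

omit [DecidableEq ι] in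
/-- **The force `g(t) = synthVel (b t)` is jointly smooth on `[0, T] × E`** (the tower `B` gives
all time-derivative families of `b`). [cite: Tao2011, Thm. 5.4 (iv) (arXiv Thm. 31)] -/
theorem smooth_force (hT : 0 < T) (hB0 : B 0 = b)
    (hB : ∀ n l, IsDomFamily T n (fun k t ξ => B k t ξ l)) :
    IsSmoothSpaceTimeOn (Icc 0 T) (fun t => synthVel (b t)) := by
  unfold IsSmoothSpaceTimeOn
  refine (contDiffOn_euclidean (ι := ι) (𝕜 := ℝ)).2 fun l => ?_
  have h1 : ContDiffOn ℝ ∞ (fun z : ℝ × EuclideanSpace ℝ ι => 𝓕 (fun ξ => b z.1 ξ l) z.2)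
      (Icc 0 T ×ˢ univ) := by
    refine contDiffOn_synth_infty_dom (W₀ := fun t ξ => b t ξ l) hT fun n => ?_
    exact ⟨fun k t ξ => B k t ξ l, by funext t ξ; simp only [hB0], hB n l⟩
  exact Complex.reCLM.contDiff.comp_contDiffOn h1

/-! ### Space derivatives of the velocity (the unforced computations, verbatim) -/

/-- The `x`-derivative of a complex velocity component:
`∂_h 𝓕 vₗ(t) = 𝓕 (-2πi⟪ξ,h⟫ vₗ(t))`. [cite: Tao2011, Thm. 5.4 (iv) (arXiv Thm. 31)] -/
theorem IsSobolevMildForced.fderiv_U (h : IsSobolevMildForced c T a b v) (hc : 0 ≤ c)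
    (ha : IsSobolevFourierDatum a) (t : ℝ) (x h' : EuclideanSpace ℝ ι) (l : ι) :
    fderiv ℝ (𝓕 (fun ξ => v t ξ l)) x h' =
      𝓕 (fun ξ => (-(2 * π * I) * (⟪ξ, h'⟫ : ℂ)) * v t ξ l) x := by
  have h1 := h.integrable_pow_mul_norm hc ha 1 t l
  simp only [pow_one] at h1
  exact fderiv_fourier_apply_of_integrable (h.integrable_apply hc ha t l) h1 x h'

/-- Complex velocity components of a forced mild solution are `C^n` in `x` for every `n`.
[cite: Tao2011, Thm. 5.4 (iv) (arXiv Thm. 31)] -/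
theorem IsSobolevMildForced.contDiff_U (h : IsSobolevMildForced c T a b v) (hc : 0 ≤ c)
    (ha : IsSobolevFourierDatum a) (t : ℝ) (l : ι) (n : ℕ) :
    ContDiff ℝ n (𝓕 (fun ξ => v t ξ l)) :=
  Real.contDiff_fourier fun m _ => h.integrable_pow_mul_norm hc ha m t l

/-- The complex velocity vector `x ↦ (𝓕 vₗ(t) x)ₗ` of a forced mild solution is `C^n`.
[cite: Tao2011, Thm. 5.4 (iv) (arXiv Thm. 31)] -/
theorem IsSobolevMildForced.contDiff_Uvec (h : IsSobolevMildForced c T a b v) (hc : 0 ≤ c)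
    (ha : IsSobolevFourierDatum a) (t : ℝ) (n : ℕ) :
    ContDiff ℝ n (fun x => fun l => 𝓕 (fun ξ => v t ξ l) x) :=
  contDiff_pi' fun l => h.contDiff_U hc ha t l n

/-- **The velocity gradient** of a forced mild solution:
`(D synthVel (v t) x h)ₗ = Re 𝓕 (-2πi⟪ξ,h⟫ vₗ)(x)`. [cite: Tao2011, Thm. 5.4 (iv) (arXiv Thm. 31)] -/
theorem IsSobolevMildForced.fderiv_u_apply (h : IsSobolevMildForced c T a b v) (hc : 0 ≤ c)
    (ha : IsSobolevFourierDatum a) (t : ℝ) (x h' : EuclideanSpace ℝ ι) (l : ι) :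
    fderiv ℝ (synthVel (v t)) x h' l =
      (𝓕 (fun ξ => (-(2 * π * I) * (⟪ξ, h'⟫ : ℂ)) * v t ξ l) x).re := by
  have hd : DifferentiableAt ℝ (fun x => fun l => 𝓕 (fun ξ => v t ξ l) x) x :=
    (h.contDiff_Uvec hc ha t 1).differentiable (by norm_num) x
  have h1 : HasFDerivAt (synthVel (v t))
      ((reVec (ι := ι)).comp (fderiv ℝ (fun x => fun l => 𝓕 (fun ξ => v t ξ l) x) x)) x := by
    rw [synthVel_eq_comp]
    exact (reVec (ι := ι)).hasFDerivAt.comp x hd.hasFDerivAt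
  rw [h1.fderiv, ContinuousLinearMap.comp_apply, reVec_apply]
  have h2 : fderiv ℝ (fun x => fun l => 𝓕 (fun ξ => v t ξ l) x) x =
      ContinuousLinearMap.pi fun l => fderiv ℝ (𝓕 (fun ξ => v t ξ l)) x :=
    fderiv_pi fun l => ((h.contDiff_U hc ha t l 1).differentiable (by norm_num)) x
  rw [h2, ContinuousLinearMap.pi_apply, h.fderiv_U hc ha]

/-- **The velocity of a forced mild solution is divergence free** for every `t`.
[cite: Tao2011, Thm. 5.4 (iv) (arXiv Thm. 31), (4)] -/
theorem IsSobolevMildForced.isDivFree_u (h : IsSobolevMildForced c T a b v) (hc : 0 ≤ c)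
    (ha : IsSobolevFourierDatum a) (t : ℝ) : VectorCalculus.IsDivFree (synthVel (v t)) := by
  classical
  intro x
  rw [divergence_eq_sum_inner_fderiv (EuclideanSpace.basisFun ι ℝ)]
  have hterm : ∀ l, ⟪(EuclideanSpace.basisFun ι ℝ) l,
      fderiv ℝ (synthVel (v t)) x ((EuclideanSpace.basisFun ι ℝ) l)⟫ =
      (𝓕 (fun ξ => (-(2 * π * I) * ((ξ l : ℝ) : ℂ)) * v t ξ l) x).re := by
    intro l
    rw [EuclideanSpace.basisFun_apply, EuclideanSpace.inner_single_left, h.fderiv_u_apply hc ha]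
    simp only [conj_trivial, one_mul, EuclideanSpace.inner_single_right]
  simp_rw [hterm]
  rw [← Complex.re_sum]
  have hint : ∀ l ∈ (Finset.univ : Finset ι), Integrable fun ξ : EuclideanSpace ℝ ι =>
      (-(2 * π * I) * ((ξ l : ℝ) : ℂ)) * v t ξ l := fun l _ => by
    have h1 := h.integrable_pow_mul_norm hc ha 1 t l
    simp only [pow_one] at h1
    exact integrable_letterSymbol_mul h1 (h.aesm_apply t l) l
  rw [← fourier_finset_sum' Finset.univ hint]
  have hzero : (fun ξ : EuclideanSpace ℝ ι => ∑ l, (-(2 * π * I) * ((ξ l : ℝ) : ℂ)) * v t ξ l) =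
      fun _ => 0 := by
    funext ξ
    have := h.divFree t ξ
    calc ∑ l, (-(2 * π * I) * ((ξ l : ℝ) : ℂ)) * v t ξ l
        = -(2 * π * I) * ∑ l, ((ξ l : ℝ) : ℂ) * v t ξ l := by
          rw [Finset.mul_sum]; refine Finset.sum_congr rfl fun l _ => ?_; ring
      _ = 0 := by rw [this, mul_zero]
  rw [hzero, fourier_zero', Complex.zero_re]

/-- **The Laplacian of the velocity** of a forced mild solution:
`(Δ synthVel (v t) x)ₗ = Re 𝓕 (-4π²‖ξ‖² vₗ)(x)`. [cite: Tao2011, Thm. 5.4 (iv) (arXiv Thm. 31)] -/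
theorem IsSobolevMildForced.laplacian_u_apply (h : IsSobolevMildForced c T a b v) (hc : 0 ≤ c)
    (ha : IsSobolevFourierDatum a) (t : ℝ) (x : EuclideanSpace ℝ ι) (l : ι) :
    (Δ (synthVel (v t))) x l =
      (𝓕 (fun ξ => (-(4 * π ^ 2 * ‖ξ‖ ^ 2 : ℝ) : ℂ) * v t ξ l) x).re := by
  have h2 : ContDiffAt ℝ 2 (fun x => fun l => 𝓕 (fun ξ => v t ξ l) x) x :=
    (h.contDiff_Uvec hc ha t 2).contDiffAt
  have h1 : (Δ (synthVel (v t))) x = reVec ((Δ (fun x => fun l => 𝓕 (fun ξ => v t ξ l) x)) x) := by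
    rw [synthVel_eq_comp]
    exact ContDiffAt.laplacian_CLM_comp_left h2
  rw [h1, reVec_apply]
  have h3 : (Δ (fun x => fun l => 𝓕 (fun ξ => v t ξ l) x)) x l =
      (Δ (fun x => 𝓕 (fun ξ => v t ξ l) x)) x := by
    have := ContDiffAt.laplacian_CLM_comp_left (l := ContinuousLinearMap.proj (R := ℝ) l) h2
    exact this.symm
  have h4 : (fun x => 𝓕 (fun ξ => v t ξ l) x) = 𝓕 (fun ξ => v t ξ l) := rfl
  rw [h3, h4, laplacian_fourier_of_moments (fun m _ => h.integrable_pow_mul_norm hc ha m t l)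
    (h.aesm_apply t l) x]

/-! ### The pressure gradient -/

/-- **The pressure gradient** on `[0, T]` along a forced mild solution:
`(∇p(t) x)ₗ = Re 𝓕 (-2πi ξₗ q(t))(x)`. [cite: Tao2011, Thm. 5.4 (iv) (arXiv Thm. 31), (9)] -/
theorem IsSobolevMildForced.gradient_p_apply (h : IsSobolevMildForced c T a b v) (hc : 0 ≤ c)
    (hT : 0 < T) (ha : IsSobolevFourierDatum a) (hB0 : B 0 = b)
    (hB : ∀ n l, IsDomFamily T n (fun k t ξ => B k t ξ l)) {t : ℝ} (ht : t ∈ Icc 0 T)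
    (x : EuclideanSpace ℝ ι) (l : ι) :
    gradient (fun y => (𝓕 (presSymbol (v t) (v t)) y).re) x l =
      (𝓕 (fun ξ => (-(2 * π * I) * ((ξ l : ℝ) : ℂ)) * presSymbol (v t) (v t) ξ) x).re := by
  classical
  set q := presSymbol (v t) (v t) with hq
  obtain ⟨C, hC⟩ := h.hasDecay_presSymbol hc hT ha hB0 hB (1 + (Fintype.card ι + 1))
  have hqd : HasDecay (1 + (Fintype.card ι + 1)) C q := (hC t ht).1
  have hqm : AEStronglyMeasurable q volume := (hC t ht).2
  have hdiff : Differentiable ℝ (𝓕 q) := differentiable_fourier' (Nat.lt_succ_self _) hqd hqm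
  have h1 : gradient (fun y => (𝓕 q y).re) x l =
      fderiv ℝ (fun y => (𝓕 q y).re) x (EuclideanSpace.single l (1 : ℝ)) := by
    have : gradient (fun y => (𝓕 q y).re) x l =
        ⟪gradient (fun y => (𝓕 q y).re) x, EuclideanSpace.single l (1 : ℝ)⟫ := by
      rw [EuclideanSpace.inner_single_right]; simp
    rw [this, gradient, InnerProductSpace.toDual_symm_apply]
  have h2 : HasFDerivAt (fun y => (𝓕 q y).re) (Complex.reCLM.comp (fderiv ℝ (𝓕 q) x)) x :=
    Complex.reCLM.hasFDerivAt.comp x (hdiff x).hasFDerivAt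
  rw [h1, h2.fderiv, ContinuousLinearMap.comp_apply, Complex.reCLM_apply,
    fderiv_fourier_apply' (Nat.lt_succ_self _) hqd hqm]
  refine congrArg Complex.re (congrFun (fourier_congr' fun ξ => ?_) x)
  rw [EuclideanSpace.inner_single_right]
  simp

/-! ### The time derivative (with force) -/

/-- **The time derivative of the velocity within `[0, T]`** for a forced mild solution:
`∂ₜ synthVel (v t) x = reVec (𝓕 (-c‖ξ‖² vₗ − N(v,v)ₗ + bₗ)(x))ₗ`. [cite: Tao2011, Thm. 5.4 (iv) (arXiv Thm. 31), (8)] -/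
theorem IsSobolevMildForced.hasDerivWithinAt_u (h : IsSobolevMildForced c T a b v) (hc : 0 ≤ c)
    (hT : 0 < T) (ha : IsSobolevFourierDatum a) (hB0 : B 0 = b)
    (hB : ∀ n l, IsDomFamily T n (fun k t ξ => B k t ξ l)) (x : EuclideanSpace ℝ ι) {t : ℝ}
    (ht : t ∈ Icc 0 T) :
    HasDerivWithinAt (fun s => synthVel (v s) x)
      (reVec fun l => 𝓕 (fun ξ => -((c * ‖ξ‖ ^ 2 : ℝ) : ℂ) * v t ξ l -
        nonlin (v t) (v t) ξ l + b t ξ l) x) (Icc 0 T) t := by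
  obtain ⟨W, hW0, hW⟩ := h.exists_family hc hT ha 1 hB0 (hB 1)
  have hbcont : ∀ ξ, ContinuousOn (fun t => b t ξ) (Icc 0 T) := continuousOn_force hB0 hB
  have hU : ∀ l, HasDerivWithinAt (fun s => 𝓕 (fun ξ => v s ξ l) x)
      (𝓕 (fun ξ => -((c * ‖ξ‖ ^ 2 : ℝ) : ℂ) * v t ξ l - nonlin (v t) (v t) ξ l + b t ξ l) x)
      (Icc 0 T) t := by
    intro l
    have hd := hasDerivWithinAt_synth_time_dom (n := 0) hT (hW l) x ht
    have hsynth : (fun s => synth (fun k t ξ => W k t ξ l) (s, x)) =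
        fun s => 𝓕 (fun ξ => v s ξ l) x := by
      funext s; simp only [synth, hW0]
    rw [hsynth] at hd
    -- identify `W 1 t ξ l` with the right-hand side by uniqueness of one-sided derivatives
    have hW1 : ∀ ξ, W 1 t ξ l =
        -((c * ‖ξ‖ ^ 2 : ℝ) : ℂ) * v t ξ l - nonlin (v t) (v t) ξ l + b t ξ l := by
      intro ξ
      have h1 := (hW l).deriv 0 Nat.zero_lt_one ξ t ht
      simp only [hW0, zero_add] at h1
      have h2 := h.hasDerivWithinAt_apply hc hT.le ha ξ (hbcont ξ) ht l
      have hud : UniqueDiffWithinAt ℝ (Icc 0 T) t := uniqueDiffOn_Icc hT t ht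
      rw [← h1.derivWithin hud, ← h2.derivWithin hud]
    have hval : synth (fun k => fun t ξ => W (k + 1) t ξ l) (t, x) =
        𝓕 (fun ξ => -((c * ‖ξ‖ ^ 2 : ℝ) : ℂ) * v t ξ l - nonlin (v t) (v t) ξ l + b t ξ l) x := by
      simp only [synth, zero_add]
      rw [show (fun ξ => W 1 t ξ l) = fun ξ => -((c * ‖ξ‖ ^ 2 : ℝ) : ℂ) * v t ξ l -
        nonlin (v t) (v t) ξ l + b t ξ l from funext hW1]
    rw [hval] at hd
    exact hd
  have hvec : HasDerivWithinAt (fun s => fun l => 𝓕 (fun ξ => v s ξ l) x)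
      (fun l => 𝓕 (fun ξ => -((c * ‖ξ‖ ^ 2 : ℝ) : ℂ) * v t ξ l - nonlin (v t) (v t) ξ l +
        b t ξ l) x) (Icc 0 T) t := hasDerivWithinAt_pi.2 hU
  exact (reVec (ι := ι)).hasFDerivAt.comp_hasDerivWithinAt t hvec

/-- The one-sided time derivative of the velocity of a forced mild solution.
[cite: Tao2011, Thm. 5.4 (iv) (arXiv Thm. 31), (8)] -/
theorem IsSobolevMildForced.timeDerivWithin_u (h : IsSobolevMildForced c T a b v) (hc : 0 ≤ c)
    (hT : 0 < T) (ha : IsSobolevFourierDatum a) (hB0 : B 0 = b)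
    (hB : ∀ n l, IsDomFamily T n (fun k t ξ => B k t ξ l)) (x : EuclideanSpace ℝ ι) {t : ℝ}
    (ht : t ∈ Icc 0 T) :
    timeDerivWithin (Icc 0 T) (fun s => synthVel (v s)) t x =
      reVec fun l => 𝓕 (fun ξ => -((c * ‖ξ‖ ^ 2 : ℝ) : ℂ) * v t ξ l -
        nonlin (v t) (v t) ξ l + b t ξ l) x := by
  rw [timeDerivWithin_apply]
  exact (h.hasDerivWithinAt_u hc hT ha hB0 hB x ht).derivWithin (uniqueDiffOn_Icc hT t ht)

/-! ### The convective term (verbatim) -/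

/-- Square integrability of the first-moment components `η ↦ ηⱼ v(t, η)ₗ` of a forced mild
solution. [cite: Tao2011, Thm. 5.4 (iv) (arXiv Thm. 31)] -/
theorem IsSobolevMildForced.memLp_coord_mul_apply (h : IsSobolevMildForced c T a b v) (hc : 0 ≤ c)
    (ha : IsSobolevFourierDatum a) (t : ℝ) (j l : ι) :
    MemLp (fun η : EuclideanSpace ℝ ι => ((η j : ℝ) : ℂ) * v t η l) 2 volume := by
  obtain ⟨G, hG, hle⟩ := h.exists_dom hc ha 1 l
  refine MemLp.of_le hG.norm ((Continuous.aestronglyMeasurable (by fun_prop)).mul (h.aesm_apply t l))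
    (Eventually.of_forall fun η => ?_)
  have h1 := hle t η
  rw [pow_one] at h1
  rw [norm_norm, Real.norm_eq_abs, abs_of_nonneg (le_trans (by positivity) h1), norm_mul,
    Complex.norm_real, Real.norm_eq_abs]
  calc |η j| * ‖v t η l‖ ≤ ‖η‖ * ‖v t η l‖ :=
        mul_le_mul_of_nonneg_right (abs_apply_le_norm η j) (norm_nonneg _)
    _ ≤ (1 + ‖η‖) * ‖v t η l‖ := by gcongr; linarith [norm_nonneg η]
    _ ≤ G η := h1

/-- **The convective term** of a forced mild solution: `((u·∇)u (t, x))ₗ = Re 𝓕 (Gₗ(t))(x)` with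
`Gₗ = ∑ⱼ (vⱼ ⋆ (-2πi ζⱼ vₗ))`. [cite: Tao2011, Thm. 5.4 (iv) (arXiv Thm. 31)] -/
theorem IsSobolevMildForced.convect_u_apply (h : IsSobolevMildForced c T a b v) (hc : 0 ≤ c)
    (ha : IsSobolevFourierDatum a) (t : ℝ) (x : EuclideanSpace ℝ ι) (l : ι) :
    convect (synthVel (v t)) (synthVel (v t)) x l =
      (𝓕 (fun ξ => ∑ j, fconv (fun η => v t η j)
        (fun ζ => (-(2 * π * I) * ((ζ j : ℝ) : ℂ)) * v t ζ l) ξ) x).re := by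
  have hvj : ∀ j, Integrable fun ξ => v t ξ j := fun j => h.integrable_apply hc ha t j
  have hdv : ∀ j, Integrable fun ζ : EuclideanSpace ℝ ι =>
      (-(2 * π * I) * ((ζ j : ℝ) : ℂ)) * v t ζ l := fun j => by
    have h1 := h.integrable_pow_mul_norm hc ha 1 t l
    simp only [pow_one] at h1
    exact integrable_letterSymbol_mul h1 (h.aesm_apply t l) j
  have hreal : ∀ j, ((synthVel (v t) x j : ℝ) : ℂ) = 𝓕 (fun ξ => v t ξ j) x := fun j => by
    rw [synthVel_apply]
    exact (fourier_eq_re_of_conj_symm (fun ξ => h.conjSymm t ξ j) x).symm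
  rw [convect_apply, h.fderiv_u_apply hc ha]
  congr 1
  have hexp : (fun ξ : EuclideanSpace ℝ ι =>
      (-(2 * π * I) * (⟪ξ, synthVel (v t) x⟫ : ℂ)) * v t ξ l) =
      fun ξ => ∑ j, 𝓕 (fun η => v t η j) x * ((-(2 * π * I) * ((ξ j : ℝ) : ℂ)) * v t ξ l) := by
    funext ξ
    rw [ClayDatum.inner_eq_sum', Complex.ofReal_sum]
    simp_rw [Complex.ofReal_mul, hreal]
    rw [Finset.mul_sum, Finset.sum_mul]
    refine Finset.sum_congr rfl fun j _ => ?_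
    ring
  rw [hexp]
  have hint : ∀ j ∈ (Finset.univ : Finset ι), Integrable fun ξ : EuclideanSpace ℝ ι =>
      𝓕 (fun η => v t η j) x * ((-(2 * π * I) * ((ξ j : ℝ) : ℂ)) * v t ξ l) :=
    fun j _ => (hdv j).const_mul _
  rw [fourier_finset_sum' Finset.univ hint]
  have hterm : ∀ j, 𝓕 (fun ξ : EuclideanSpace ℝ ι => 𝓕 (fun η => v t η j) x *
      ((-(2 * π * I) * ((ξ j : ℝ) : ℂ)) * v t ξ l)) x =
      𝓕 (fconv (fun η => v t η j) (fun ζ => (-(2 * π * I) * ((ζ j : ℝ) : ℂ)) * v t ζ l)) x :=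
    fun j => by rw [fourier_const_mul', fourier_mul_fourier' (hvj j) (hdv j)]
  simp_rw [hterm]
  have hint2 : ∀ j ∈ (Finset.univ : Finset ι), Integrable
      (fconv (fun η => v t η j) (fun ζ => (-(2 * π * I) * ((ζ j : ℝ) : ℂ)) * v t ζ l)) :=
    fun j _ => integrable_fconv (hvj j) (hdv j)
  rw [← fourier_finset_sum' Finset.univ hint2]

/-- **Incompressibility inside the convolution** for a forced mild solution:
`Gₗ = -2πi ∑ⱼ ξⱼ (vⱼ ⋆ vₗ)`. [cite: Tao2011, Thm. 5.4 (iv) (arXiv Thm. 31), (4)] -/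
theorem IsSobolevMildForced.G_eq (h : IsSobolevMildForced c T a b v) (hc : 0 ≤ c)
    (ha : IsSobolevFourierDatum a) (t : ℝ) (ξ : EuclideanSpace ℝ ι) (l : ι) :
    ∑ j, fconv (fun η => v t η j) (fun ζ => (-(2 * π * I) * ((ζ j : ℝ) : ℂ)) * v t ζ l) ξ =
      -(2 * π * I) * ∑ j, ((ξ j : ℝ) : ℂ) * fconv (fun η => v t η j) (fun η => v t η l) ξ := by
  have hv2 : ∀ j, MemLp (v t · j) 2 volume := fun j => h.memLp_apply hc ha t j
  have hI1 : ∀ j, Integrable fun η => v t η j * v t (ξ - η) l := fun j =>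
    integrable_fconv_integrand (hv2 j) (hv2 l) ξ
  have hI2 : ∀ j, Integrable fun η => (((η j : ℝ) : ℂ) * v t η j) * v t (ξ - η) l := fun j =>
    integrable_fconv_integrand (h.memLp_coord_mul_apply hc ha t j j) (hv2 l) ξ
  have hsplit : ∀ j, fconv (fun η => v t η j) (fun ζ => (-(2 * π * I) * ((ζ j : ℝ) : ℂ)) * v t ζ l) ξ =
      -(2 * π * I) * (((ξ j : ℝ) : ℂ) * fconv (fun η => v t η j) (fun η => v t η l) ξ) +
        (2 * π * I) * ∫ η, (((η j : ℝ) : ℂ) * v t η j) * v t (ξ - η) l := by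
    intro j
    rw [fconv_apply, fconv_apply, ← integral_const_mul, ← integral_const_mul, ← integral_const_mul,
      ← integral_add ((hI1 j).const_mul _ |>.const_mul _) ((hI2 j).const_mul _)]
    refine integral_congr_ae (Eventually.of_forall fun η => ?_)
    simp only [PiLp.sub_apply, Complex.ofReal_sub]
    ring
  simp_rw [hsplit]
  rw [Finset.sum_add_distrib, ← Finset.mul_sum, ← Finset.mul_sum]
  have hzero : ∑ j, ∫ η, (((η j : ℝ) : ℂ) * v t η j) * v t (ξ - η) l = 0 := by
    rw [← integral_finsetSum Finset.univ fun j _ => hI2 j]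
    have : (fun η : EuclideanSpace ℝ ι => ∑ j, (((η j : ℝ) : ℂ) * v t η j) * v t (ξ - η) l) =
        fun _ => 0 := by
      funext η
      rw [← Finset.sum_mul, h.divFree t η, zero_mul]
    rw [this, integral_zero]
  rw [hzero, mul_zero, add_zero]

/-! ### The forced Navier–Stokes system -/

/-- Integrability of the Fourier-side time derivative `-c‖ξ‖² vₗ − Nₗ + bₗ` on `[0, T]` for a
forced mild solution. [cite: Tao2011, Thm. 5.4 (iv) (arXiv Thm. 31), (8)] -/
theorem IsSobolevMildForced.integrable_Dt (h : IsSobolevMildForced c T a b v) (hc : 0 ≤ c)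
    (hT : 0 < T) (ha : IsSobolevFourierDatum a) (hB0 : B 0 = b)
    (hB : ∀ n l, IsDomFamily T n (fun k t ξ => B k t ξ l)) {t : ℝ} (ht : t ∈ Icc 0 T) (l : ι) :
    Integrable fun ξ : EuclideanSpace ℝ ι =>
      -((c * ‖ξ‖ ^ 2 : ℝ) : ℂ) * v t ξ l - nonlin (v t) (v t) ξ l + b t ξ l := by
  have h1 : Integrable fun ξ : EuclideanSpace ℝ ι => -((c * ‖ξ‖ ^ 2 : ℝ) : ℂ) * v t ξ l := by
    refine ((h.integrable_pow_mul_norm hc ha 2 t l).const_mul c).mono'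
      ((Continuous.aestronglyMeasurable (by fun_prop)).mul (h.aesm_apply t l))
      (Eventually.of_forall fun ξ => ?_)
    rw [norm_mul, norm_neg, Complex.norm_real, Real.norm_of_nonneg (by positivity)]
    ring_nf; rfl
  obtain ⟨C, hC⟩ := h.hasDecay_nonlin hc hT ha hB0 hB (Fintype.card ι + 1) l
  exact (h1.sub ((hC t ht).1.integrable (finrank_lt_of_card_lt (Nat.lt_succ_self _))
    (hC t ht).2)).add (integrable_force_apply hB0 hB ht l)

/-- **The forced momentum equation** on `[0, T] × E`: `∂ₜu + (u·∇)u = νΔu − ∇p + g` for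
`c = 4π²ν`, `g(t) = synthVel (b t)` the synthesized (projected) force (componentwise: linearity
of `𝓕`, the symbol identity `G − N − 2πi ξ q = 0`, and `Re 𝓕 bₗ = gₗ`). [cite: Tao2011, Thm. 5.4 (iv) (arXiv Thm. 31), (3) and (8)] -/
theorem IsSobolevMildForced.momentum {ν : ℝ} (h : IsSobolevMildForced (4 * π ^ 2 * ν) T a b v)
    (hν : 0 ≤ ν) (hT : 0 < T) (ha : IsSobolevFourierDatum a) (hB0 : B 0 = b)
    (hB : ∀ n l, IsDomFamily T n (fun k t ξ => B k t ξ l)) {t : ℝ} (ht : t ∈ Icc 0 T)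
    (x : EuclideanSpace ℝ ι) :
    timeDerivWithin (Icc 0 T) (fun s => synthVel (v s)) t x +
        convect (synthVel (v t)) (synthVel (v t)) x =
      ν • (Δ (synthVel (v t))) x - gradient (fun y => (𝓕 (presSymbol (v t) (v t)) y).re) x +
        (fun s => synthVel (b s)) t x := by
  have hc : 0 ≤ 4 * π ^ 2 * ν := by positivity
  ext l
  rw [PiLp.add_apply, PiLp.add_apply, PiLp.sub_apply, PiLp.smul_apply,
    h.timeDerivWithin_u hc hT ha hB0 hB x ht, reVec_apply, h.convect_u_apply hc ha,
    h.laplacian_u_apply hc ha, h.gradient_p_apply hc hT ha hB0 hB ht, smul_eq_mul, synthVel_apply]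
  -- reduce to an identity of complex Fourier integrals
  rw [← Complex.add_re, ← Complex.re_ofReal_mul, ← Complex.sub_re, ← Complex.add_re]
  congr 1
  -- integrability of the transformed terms
  have hvj : ∀ j, Integrable fun ξ => v t ξ j := fun j => h.integrable_apply hc ha t j
  have hdv : ∀ j, Integrable fun ζ : EuclideanSpace ℝ ι =>
      (-(2 * π * I) * ((ζ j : ℝ) : ℂ)) * v t ζ l := fun j => by
    have h1 := h.integrable_pow_mul_norm hc ha 1 t l
    simp only [pow_one] at h1
    exact integrable_letterSymbol_mul h1 (h.aesm_apply t l) j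
  have hiG : Integrable fun ξ => ∑ j, fconv (fun η => v t η j)
      (fun ζ => (-(2 * π * I) * ((ζ j : ℝ) : ℂ)) * v t ζ l) ξ :=
    integrable_finsetSum _ fun j _ => integrable_fconv (hvj j) (hdv j)
  have hilap : Integrable fun ξ : EuclideanSpace ℝ ι =>
      (-(4 * π ^ 2 * ‖ξ‖ ^ 2 : ℝ) : ℂ) * v t ξ l := by
    refine ((h.integrable_pow_mul_norm hc ha 2 t l).const_mul (4 * π ^ 2)).mono'
      ((Continuous.aestronglyMeasurable (by fun_prop)).mul (h.aesm_apply t l))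
      (Eventually.of_forall fun ξ => ?_)
    rw [norm_mul, norm_neg, Complex.norm_real, Real.norm_of_nonneg (by positivity)]
    ring_nf; rfl
  have higradq : Integrable fun ξ : EuclideanSpace ℝ ι =>
      (-(2 * π * I) * ((ξ l : ℝ) : ℂ)) * presSymbol (v t) (v t) ξ := by
    obtain ⟨C, hC⟩ := h.hasDecay_presSymbol hc hT ha hB0 hB (1 + (Fintype.card ι + 1))
    have hq1 : Integrable fun ξ : EuclideanSpace ℝ ι => ‖ξ‖ * ‖presSymbol (v t) (v t) ξ‖ := by
      simpa using (hC t ht).1.integrable_pow_mul_norm (n := 1)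
        (finrank_lt_of_card_lt (Nat.lt_succ_self _)) (hC t ht).2
    exact integrable_letterSymbol_mul hq1 (hC t ht).2 l
  have hib : Integrable fun ξ => b t ξ l := integrable_force_apply hB0 hB ht l
  rw [← fourier_add' (h.integrable_Dt hc hT ha hB0 hB ht l) hiG, ← fourier_const_mul' (ν : ℂ),
    ← fourier_sub' (hilap.const_mul _) higradq, ← fourier_add' ((hilap.const_mul _).sub higradq) hib]
  refine congrFun (fourier_congr' fun ξ => ?_) x
  simp only [Pi.add_apply, Pi.sub_apply]
  have key := momentum_symbol_identity (v t) ξ l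
  rw [h.G_eq hc ha t ξ l]
  have hcν : (((4 * π ^ 2 * ν) * ‖ξ‖ ^ 2 : ℝ) : ℂ) = (ν : ℂ) * ((4 * π ^ 2 * ‖ξ‖ ^ 2 : ℝ) : ℂ) := by
    push_cast; ring
  rw [hcν]
  linear_combination key

/-- **`(u, p)` is a classical solution of the Navier–Stokes system with viscosity `ν` and the
synthesized (projected) force `g(t) = synthVel (b t)` on the closed slab `[0, T] × E`**,
`u(t) = synthVel (v t)`, `p(t) = Re 𝓕 presSymbol (v t) (v t)`, for every forced Fourier-side mild
solution of Sobolev class with heat rate `c = 4π²ν` whose force carries a derivative tower of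
square-dominated families (Tao 2011, Thm. 5.4 (iv): the `H¹` mild solution `(u, p, u₀, f, T)`
with Schwartz data is smooth and solves (3)–(5) on `[0, T] × ℝ³` with the force `P f` and the
Riesz-transform pressure (9); Leray 1934, §19). The gauge change to a raw (non-projected) force
`f = P f + ∇φ`, `p ↦ p − φ`, is left to the assembly file, which knows `f`.
[cite: Tao2011, Thm. 5.4 (iv) (arXiv Thm. 31)] -/
theorem IsSobolevMildForced.isClassicalNSSolutionOn {ν : ℝ}
    (h : IsSobolevMildForced (4 * π ^ 2 * ν) T a b v) (hν : 0 ≤ ν) (hT : 0 < T)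
    (ha : IsSobolevFourierDatum a) (hB0 : B 0 = b)
    (hB : ∀ n l, IsDomFamily T n (fun k t ξ => B k t ξ l)) :
    IsClassicalNSSolutionOn (Icc 0 T) ν (fun t => synthVel (b t)) (fun t => synthVel (v t))
      (fun t x => (𝓕 (presSymbol (v t) (v t)) x).re) where
  smooth_velocity := h.smooth_u (by positivity) hT ha hB0 hB
  smooth_pressure := h.smooth_p (by positivity) hT ha hB0 hB
  momentum _ ht x := h.momentum hν hT ha hB0 hB ht x
  divFree t _ := h.isDivFree_u (by positivity) ha t

end Solution

end Literature.Analysis.FluidPDE.FourierNS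

end
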